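import Summits.Ventures.PercRepro.GenQHypAddTwoB

/-!
# PercRepro — C-025 at `(q + 2, q)`: «hyperplane + two points» at EVERY type, part C — the four families of
rank-`(q + 1)` subsets (night-4, gen 2; part D = `GenQHypAddTwoD.lean`)

`GenQHypAddTwo(B).lean` handles the top type: for `G = τ ∪ {a, a′}` (`ρ(τ) = q`, `a, a′ ∉ cl(τ)`, `ρ(G) = q + 1`)
the balance `Jq M G (q + 1) (q + 1)` dominates `2 · Jq M τ q q`.  At a LOWER type `t ≤ q` the rank-`(q + 1)` subsets
of `G` fall into FOUR families — `B″ ∪ {a}`, `B″ ∪ {a′}`, `B″ ∪ {a, a′}` over `B″ ∈ R_q(τ)` and `B″ ∪ {a, a′}` over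
`B″ ∈ R_{q−1}(τ)` (`Rq_succ_eq_union`) — with coloop counts `m(B″) + 1`, `m(B″) + 1`, `≤ m(B″)`, `≤ m(B″) + 2` and
demands `[ρ(τ ∖ B″) + 2 > t]`, `[ρ(τ ∖ B″) + 2 > t]`, `[ρ(τ ∖ B″) + 1 > t]`, `[ρ(τ ∖ B″) + 1 > t]`.
This part proves the decomposition: the complements `G ∖ B` of the four shapes (`sdiff_insert_left` / `_right` /
`sdiff_insert_insert`), the membership of the four images in `R_{q+1}(G)`, the covering (`mem_Rq_succ_cases`), the
injectivity of the three maps on subsets of `τ`, the pairwise disjointness of the families and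
**`Rq_succ_eq_union`**; also `Jq_eq_sum_dem`, the balance as one signed sum with the demand indicator `dem`.  Part D
sums the four contributions into the profile functional and proves `Jq_hyp_add_two_ge_profile`.
Imports `GenQHypAddTwoB` (hence the coloop lemmas of `GenQHypAddTwo`).
-/

namespace PercRepro.GenQ

open Finset ThmH SixFour

variable {α : Type*} [DecidableEq α] {M : Matroid α} [M.Finite]

/-! ## The balance as one signed sum -/

/-- The demand indicator of `B ⊆ G` at type `t`: `1` if `ρ(G ∖ B) ≥ t`, else `0`. -/
noncomputable def dem (M : Matroid α) [M.Finite] (G : Finset α) (t : ℕ) (B : Finset α) : ℚ :=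
  if M.eRk ((G \ B : Finset α) : Set α) + 1 ≤ (t : ℕ∞) then 0 else 1

/-- `Jq M G q t = Σ_{B ∈ R_q(G)} ((q + 2 − t)·w_∞(B) − Φ·dem(B))`. -/
theorem Jq_eq_sum_dem (G : Finset α) (q t : ℕ) :
    Jq M G q t = ∑ B ∈ Rq M G q,
      (((q : ℚ) + 2 - t) * wInf M B - (((q : ℚ) + 2) / ((q : ℚ) + 1)) * dem M G t B) := by
  unfold Jq
  rw [Nq_sub_DFq, Finset.sum_sub_distrib]
  congr 1
  unfold dem
  rw [Finset.card_filter]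
  push_cast
  rw [Finset.mul_sum]
  apply Finset.sum_congr rfl
  intro B _
  split_ifs <;> simp

/-! ## The setting: `G = τ ∪ {a, a′}` at every type -/

section HypAddTwoAll

variable {τ : Finset α} {a a' : α} {q t : ℕ}

/-! ### Complements inside `G = τ ∪ {a, a′}` -/

omit [M.Finite] in
/-- `G ∖ (B ∪ {a}) = (τ ∖ B) ∪ {a′}` for `B ⊆ τ`. -/
theorem sdiff_insert_left (hne : a ≠ a') (haτ : a ∉ τ) (ha'τ : a' ∉ τ) {B : Finset α} (hB : B ⊆ τ) :
    (insert a (insert a' τ)) \ (insert a B) = insert a' (τ \ B) := by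
  ext x
  simp only [Finset.mem_sdiff, Finset.mem_insert]
  constructor
  · rintro ⟨h1, h2⟩
    push Not at h2
    rcases h1 with rfl | rfl | h
    · exact absurd rfl h2.1
    · exact Or.inl rfl
    · exact Or.inr ⟨h, h2.2⟩
  · rintro (rfl | ⟨h1, h2⟩)
    · refine ⟨Or.inr (Or.inl rfl), ?_⟩
      push Not
      exact ⟨hne.symm, fun h => ha'τ (hB h)⟩
    · refine ⟨Or.inr (Or.inr h1), ?_⟩
      push Not
      exact ⟨fun h => haτ (h ▸ h1), h2⟩

omit [M.Finite] in
/-- `G ∖ (B ∪ {a′}) = (τ ∖ B) ∪ {a}` for `B ⊆ τ`. -/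
theorem sdiff_insert_right (hne : a ≠ a') (haτ : a ∉ τ) (ha'τ : a' ∉ τ) {B : Finset α} (hB : B ⊆ τ) :
    (insert a (insert a' τ)) \ (insert a' B) = insert a (τ \ B) := by
  rw [Finset.insert_comm]
  exact sdiff_insert_left hne.symm ha'τ haτ hB

omit [M.Finite] in
/-- `G ∖ (B ∪ {a, a′}) = τ ∖ B` for `B ⊆ τ`. -/
theorem sdiff_insert_insert (haτ : a ∉ τ) (ha'τ : a' ∉ τ) (B : Finset α) :
    (insert a (insert a' τ)) \ (insert a (insert a' B)) = τ \ B := by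
  ext x
  simp only [Finset.mem_sdiff, Finset.mem_insert]
  constructor
  · rintro ⟨h1, h2⟩
    push Not at h2
    rcases h1 with rfl | rfl | h
    · exact absurd rfl h2.1
    · exact absurd rfl h2.2.1
    · exact ⟨h, h2.2.2⟩
  · rintro ⟨h1, h2⟩
    refine ⟨Or.inr (Or.inr h1), ?_⟩
    push Not
    exact ⟨fun h => haτ (h ▸ h1), fun h => ha'τ (h ▸ h1), h2⟩

/-- A point off `cl(τ)` raises the rank of every subset of `τ` by one. -/
theorem eRk_insert_sub (ha : a ∈ gr M) (hacl : a ∉ M.closure (τ : Set α)) {X : Finset α} (hX : X ⊆ τ) :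
    M.eRk ((insert a X : Finset α) : Set α) = M.eRk (X : Set α) + 1 := by
  have haE : a ∈ M.E := by
    rw [← coe_gr M]
    exact_mod_cast ha
  have hcl : a ∉ M.closure (X : Set α) := fun h =>
    hacl (M.closure_subset_closure (Finset.coe_subset.2 hX) h)
  rw [Finset.coe_insert, Matroid.eRk_insert_eq_add_one ⟨haE, hcl⟩]

/-! ### The four families of rank-`(q + 1)` subsets of `G` -/

/-- The fourth family: the rank-`(q − 1)` subsets `B″ ⊆ τ` with `ρ(B″ ∪ {a, a′}) = q + 1`. -/
noncomputable def RqPred (M : Matroid α) [M.Finite] (τ : Finset α) (a a' : α) (q : ℕ) : Finset (Finset α) :=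
  (Rq M τ (q - 1)).filter (fun B => M.eRk ((insert a (insert a' B) : Finset α) : Set α) = (q : ℕ∞) + 1)

/-- `B″ ∪ {a} ∈ R_{q+1}(G)` for `B″ ∈ R_q(τ)`. -/
theorem insert_left_mem_Rq (ha : a ∈ gr M) (hacl : a ∉ M.closure (τ : Set α)) {B : Finset α}
    (hB : B ∈ Rq M τ q) : insert a B ∈ Rq M (insert a (insert a' τ)) (q + 1) := by
  rw [mem_Rq] at hB ⊢
  refine ⟨Finset.insert_subset (Finset.mem_insert_self _ _)
    (hB.1.trans ((Finset.subset_insert _ _).trans (Finset.subset_insert _ _))), ?_⟩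
  rw [eRk_insert_sub ha hacl hB.1, hB.2]
  push_cast
  rfl

/-- `B″ ∪ {a′} ∈ R_{q+1}(G)` for `B″ ∈ R_q(τ)`. -/
theorem insert_right_mem_Rq (ha' : a' ∈ gr M) (ha'cl : a' ∉ M.closure (τ : Set α)) {B : Finset α}
    (hB : B ∈ Rq M τ q) : insert a' B ∈ Rq M (insert a (insert a' τ)) (q + 1) := by
  rw [mem_Rq] at hB ⊢
  refine ⟨Finset.insert_subset (Finset.mem_insert_of_mem (Finset.mem_insert_self _ _))
    (hB.1.trans ((Finset.subset_insert _ _).trans (Finset.subset_insert _ _))), ?_⟩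
  rw [eRk_insert_sub ha' ha'cl hB.1, hB.2]
  push_cast
  rfl

/-- `B″ ∪ {a, a′} ⊆ G` for `B″ ⊆ τ`. -/
theorem insert_insert_subset {B : Finset α} (hB : B ⊆ τ) :
    insert a (insert a' B) ⊆ insert a (insert a' τ) :=
  Finset.insert_subset_insert _ (Finset.insert_subset_insert _ hB)

/-- `B″ ∪ {a, a′} ∈ R_{q+1}(G)` for `B″ ∈ R_q(τ)`. -/
theorem insert_insert_mem_Rq (ha' : a' ∈ gr M) (ha'cl : a' ∉ M.closure (τ : Set α))
    (hrG : M.eRk ((insert a (insert a' τ) : Finset α) : Set α) = (q : ℕ∞) + 1) {B : Finset α}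
    (hB : B ∈ Rq M τ q) : insert a (insert a' B) ∈ Rq M (insert a (insert a' τ)) (q + 1) := by
  rw [mem_Rq] at hB ⊢
  refine ⟨insert_insert_subset hB.1, le_antisymm ?_ ?_⟩
  · rw [Nat.cast_add_one, ← hrG]
    exact M.eRk_mono (Finset.coe_subset.2 (insert_insert_subset hB.1))
  · rw [Nat.cast_add_one, ← hB.2, ← eRk_insert_sub ha' ha'cl hB.1]
    exact M.eRk_mono (Finset.coe_subset.2 (Finset.subset_insert _ _))

/-- `B″ ∪ {a, a′} ∈ R_{q+1}(G)` for `B″ ∈ RqPred`. -/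
theorem insert_insert_mem_Rq_of_pred {B : Finset α} (hB : B ∈ RqPred M τ a a' q) :
    insert a (insert a' B) ∈ Rq M (insert a (insert a' τ)) (q + 1) := by
  unfold RqPred at hB
  rw [Finset.mem_filter, mem_Rq] at hB
  rw [mem_Rq]
  refine ⟨insert_insert_subset hB.1.1, ?_⟩
  rw [hB.2]
  push_cast
  rfl

/-- Erasing `a` and `a′` from a subset of `G` lands in `τ`. -/
theorem erase_erase_subset {B : Finset α} (hB : B ⊆ insert a (insert a' τ)) : (B.erase a).erase a' ⊆ τ := by
  intro x hx
  rw [Finset.mem_erase, Finset.mem_erase] at hx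
  have := hB hx.2.2
  rw [Finset.mem_insert, Finset.mem_insert] at this
  rcases this with h | h | h
  · exact absurd h hx.2.1
  · exact absurd h hx.1
  · exact h

/-- **The covering**: every rank-`(q + 1)` subset of `G` is in one of the four families. -/
theorem mem_Rq_succ_cases (ha : a ∈ gr M) (ha' : a' ∈ gr M) (hne : a ≠ a')
    (hacl : a ∉ M.closure (τ : Set α)) (ha'cl : a' ∉ M.closure (τ : Set α))
    (hrτ : M.eRk (τ : Set α) = (q : ℕ∞)) (hq : 1 ≤ q) {B : Finset α}
    (hB : B ∈ Rq M (insert a (insert a' τ)) (q + 1)) :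
    (∃ B'' ∈ Rq M τ q, B = insert a B'') ∨ (∃ B'' ∈ Rq M τ q, B = insert a' B'') ∨
      (∃ B'' ∈ Rq M τ q, B = insert a (insert a' B'')) ∨
      (∃ B'' ∈ RqPred M τ a a' q, B = insert a (insert a' B'')) := by
  rw [mem_Rq] at hB
  obtain ⟨hBG, hBr⟩ := hB
  have hsub := erase_erase_subset hBG
  obtain ⟨k, hk, -⟩ := eRk_eq_nat M ((B.erase a).erase a')
  by_cases haB : a ∈ B <;> by_cases ha'B : a' ∈ B
  · -- both points: `B = B″ ∪ {a, a′}`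
    have hBeq : B = insert a (insert a' ((B.erase a).erase a')) := by
      rw [Finset.insert_erase (Finset.mem_erase.2 ⟨hne.symm, ha'B⟩), Finset.insert_erase haB]
    have hr1 : M.eRk ((insert a' ((B.erase a).erase a') : Finset α) : Set α) = (k : ℕ∞) + 1 := by
      rw [eRk_insert_sub ha' ha'cl hsub, hk]
    have hle : M.eRk ((insert a' ((B.erase a).erase a') : Finset α) : Set α) ≤ M.eRk (B : Set α) := by
      conv_rhs => rw [hBeq]
      exact M.eRk_mono (Finset.coe_subset.2 (Finset.subset_insert _ _))
    have hge : M.eRk (B : Set α) ≤ M.eRk ((insert a' ((B.erase a).erase a') : Finset α) : Set α) + 1 := by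
      conv_lhs => rw [hBeq]
      rw [Finset.coe_insert]
      exact M.eRk_insert_le_add_one _ _
    rw [hr1, hBr] at hle hge
    have hle' : k + 1 ≤ q + 1 := by exact_mod_cast hle
    have hge' : q + 1 ≤ k + 1 + 1 := by exact_mod_cast hge
    by_cases hkq : k = q
    · right; right; left
      refine ⟨(B.erase a).erase a', mem_Rq.2 ⟨hsub, by rw [hk, hkq]⟩, hBeq⟩
    · right; right; right
      have hk' : k = q - 1 := by omega
      refine ⟨(B.erase a).erase a', ?_, hBeq⟩
      unfold RqPred
      rw [Finset.mem_filter, mem_Rq]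
      refine ⟨⟨hsub, by rw [hk, hk']⟩, ?_⟩
      rw [← hBeq, hBr]
      push_cast
      rfl
  · -- only `a`
    left
    have he : (B.erase a).erase a' = B.erase a := Finset.erase_eq_of_notMem (fun h => ha'B (Finset.mem_of_mem_erase h))
    have hBeq : B = insert a ((B.erase a).erase a') := by rw [he, Finset.insert_erase haB]
    refine ⟨(B.erase a).erase a', mem_Rq.2 ⟨hsub, ?_⟩, hBeq⟩
    have hr1 : M.eRk ((insert a ((B.erase a).erase a') : Finset α) : Set α) = (k : ℕ∞) + 1 := by
      rw [eRk_insert_sub ha hacl hsub, hk]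
    rw [← hBeq, hBr] at hr1
    have : q + 1 = k + 1 := by exact_mod_cast hr1
    rw [hk]
    congr 1
    omega
  · -- only `a′`
    right; left
    have he : (B.erase a).erase a' = B.erase a' := by
      rw [Finset.erase_eq_of_notMem haB]
    have hBeq : B = insert a' ((B.erase a).erase a') := by rw [he, Finset.insert_erase ha'B]
    refine ⟨(B.erase a).erase a', mem_Rq.2 ⟨hsub, ?_⟩, hBeq⟩
    have hr1 : M.eRk ((insert a' ((B.erase a).erase a') : Finset α) : Set α) = (k : ℕ∞) + 1 := by
      rw [eRk_insert_sub ha' ha'cl hsub, hk]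
    rw [← hBeq, hBr] at hr1
    have : q + 1 = k + 1 := by exact_mod_cast hr1
    rw [hk]
    congr 1
    omega
  · -- neither: `B ⊆ τ` has rank `≤ q`
    exfalso
    have hBτ : B ⊆ τ := by
      intro x hx
      have := hBG hx
      rw [Finset.mem_insert, Finset.mem_insert] at this
      rcases this with h | h | h
      · exact absurd (h ▸ hx) haB
      · exact absurd (h ▸ hx) ha'B
      · exact h
    have := M.eRk_mono (Finset.coe_subset.2 hBτ)
    rw [hBr, hrτ] at this
    exact enat_succ_not_le q this

/-! ### Injectivity and disjointness of the four families -/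

omit [M.Finite] in
/-- `B ↦ B ∪ {a}` is injective on the subsets of `τ`. -/
theorem insert_inj_of_subset (haτ : a ∉ τ) {B B' : Finset α} (hB : B ⊆ τ) (hB' : B' ⊆ τ)
    (h : insert a B = insert a B') : B = B' := by
  have h2 : (insert a B).erase a = (insert a B').erase a := by rw [h]
  rwa [Finset.erase_insert (fun h => haτ (hB h)), Finset.erase_insert (fun h => haτ (hB' h))] at h2

omit [M.Finite] in
/-- `B ↦ B ∪ {a, a′}` is injective on the subsets of `τ`. -/
theorem insert_insert_inj_of_subset (hne : a ≠ a') (haτ : a ∉ τ) (ha'τ : a' ∉ τ) {B B' : Finset α}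
    (hB : B ⊆ τ) (hB' : B' ⊆ τ) (h : insert a (insert a' B) = insert a (insert a' B')) : B = B' := by
  have h1 : insert a' B = insert a' B' := by
    apply insert_inj_of_subset (τ := insert a' τ) (by
      rw [Finset.mem_insert]
      rintro (h | h)
      · exact hne h
      · exact haτ h) (Finset.insert_subset_insert _ hB) (Finset.insert_subset_insert _ hB') h
  exact insert_inj_of_subset ha'τ hB hB' h1

/-- The elements of `RqPred` are subsets of `τ`. -/
theorem subset_of_mem_RqPred {B : Finset α} (hB : B ∈ RqPred M τ a a' q) : B ⊆ τ := by
  unfold RqPred at hB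
  exact (mem_Rq.1 (Finset.mem_filter.1 hB).1).1

/-- **The decomposition of `R_{q+1}(G)` into the four families.** -/
theorem Rq_succ_eq_union (ha : a ∈ gr M) (ha' : a' ∈ gr M) (hne : a ≠ a')
    (hacl : a ∉ M.closure (τ : Set α)) (ha'cl : a' ∉ M.closure (τ : Set α))
    (hrτ : M.eRk (τ : Set α) = (q : ℕ∞)) (hrG : M.eRk ((insert a (insert a' τ) : Finset α) : Set α) = (q : ℕ∞) + 1)
    (hq : 1 ≤ q) :
    Rq M (insert a (insert a' τ)) (q + 1) =
      (((Rq M τ q).image (fun B => insert a B) ∪ (Rq M τ q).image (fun B => insert a' B)) ∪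
        (Rq M τ q).image (fun B => insert a (insert a' B))) ∪
        (RqPred M τ a a' q).image (fun B => insert a (insert a' B)) := by
  ext B
  simp only [Finset.mem_union, Finset.mem_image]
  constructor
  · intro hB
    rcases mem_Rq_succ_cases ha ha' hne hacl ha'cl hrτ hq hB with
      ⟨B'', h, rfl⟩ | ⟨B'', h, rfl⟩ | ⟨B'', h, rfl⟩ | ⟨B'', h, rfl⟩
    · exact Or.inl (Or.inl (Or.inl ⟨B'', h, rfl⟩))
    · exact Or.inl (Or.inl (Or.inr ⟨B'', h, rfl⟩))
    · exact Or.inl (Or.inr ⟨B'', h, rfl⟩)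
    · exact Or.inr ⟨B'', h, rfl⟩
  · rintro (((⟨B'', h, rfl⟩ | ⟨B'', h, rfl⟩) | ⟨B'', h, rfl⟩) | ⟨B'', h, rfl⟩)
    · exact insert_left_mem_Rq ha hacl h
    · exact insert_right_mem_Rq ha' ha'cl h
    · exact insert_insert_mem_Rq ha' ha'cl hrG h
    · exact insert_insert_mem_Rq_of_pred h

/-- Disjointness of the first two families. -/
theorem disjoint_im₁_im₂ (hne : a ≠ a') (haτ : a ∉ τ) :
    Disjoint ((Rq M τ q).image (fun B => insert a B)) ((Rq M τ q).image (fun B => insert a' B)) := by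
  rw [Finset.disjoint_left]
  intro S h1 h2
  rw [Finset.mem_image] at h1 h2
  obtain ⟨B, hB, rfl⟩ := h1
  obtain ⟨B', hB', hB'eq⟩ := h2
  have : a ∈ insert a' B' := by
    rw [hB'eq]
    exact Finset.mem_insert_self _ _
  rcases Finset.mem_insert.1 this with h | h
  · exact hne h
  · exact haτ ((mem_Rq.1 hB').1 h)

/-- The first two families are disjoint from any family of sets `B ∪ {a, a′}`, `B ⊆ τ`. -/
theorem disjoint_im₁₂_im (hne : a ≠ a') (haτ : a ∉ τ) (ha'τ : a' ∉ τ) (D : Finset (Finset α)) :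
    Disjoint ((Rq M τ q).image (fun B => insert a B) ∪ (Rq M τ q).image (fun B => insert a' B))
      (D.image (fun B => insert a (insert a' B))) := by
  rw [Finset.disjoint_left]
  intro S h1 h2
  rw [Finset.mem_image] at h2
  obtain ⟨B', -, rfl⟩ := h2
  rw [Finset.mem_union, Finset.mem_image, Finset.mem_image] at h1
  rcases h1 with ⟨B, hB, hBeq⟩ | ⟨B, hB, hBeq⟩
  · have : a' ∈ insert a B := by
      rw [hBeq]
      exact Finset.mem_insert_of_mem (Finset.mem_insert_self _ _)
    rcases Finset.mem_insert.1 this with h | h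
    · exact hne h.symm
    · exact ha'τ ((mem_Rq.1 hB).1 h)
  · have : a ∈ insert a' B := by
      rw [hBeq]
      exact Finset.mem_insert_self _ _
    rcases Finset.mem_insert.1 this with h | h
    · exact hne h
    · exact haτ ((mem_Rq.1 hB).1 h)

/-- Disjointness of the third and fourth families (ranks `q` and `q − 1`, `q ≥ 1`). -/
theorem disjoint_im₃_im₄ (hne : a ≠ a') (haτ : a ∉ τ) (ha'τ : a' ∉ τ) (hq : 1 ≤ q) :
    Disjoint ((Rq M τ q).image (fun B => insert a (insert a' B)))
      ((RqPred M τ a a' q).image (fun B => insert a (insert a' B))) := by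
  rw [Finset.disjoint_left]
  intro S h1 h2
  rw [Finset.mem_image] at h1 h2
  obtain ⟨B, hB, rfl⟩ := h1
  obtain ⟨B', hB', hB'eq⟩ := h2
  have hBB' := insert_insert_inj_of_subset hne haτ ha'τ (subset_of_mem_RqPred hB') (mem_Rq.1 hB).1 hB'eq
  subst hBB'
  have h1 := (mem_Rq.1 hB).2
  unfold RqPred at hB'
  have h2 := (mem_Rq.1 (Finset.mem_filter.1 hB').1).2
  rw [h1] at h2
  have : q = q - 1 := by exact_mod_cast h2
  omega

end HypAddTwoAll

end PercRepro.GenQ
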